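import Summits.CriticalPhenomena.Ising3DConformalLimit.Theorems.EnergyNotSigmaSquaredMoebiusLimitExistsPinnedTwoPoint
import Mathlib.Topology.Sequences
import Mathlib.Topology.UniformSpace.HeineCantor
import HarnessLib

/-!
# Asymptotic equicontinuity of the pinned pair zoom of the critical `ℤ³` correlators
(line `only-interaction-breaks-moebius` of the crux `MoebiusLimitExists`, item stmt-CriticalPhenomena-1344;
registered sub-goal `pinnedZoomEquicontinuous_two` — the `n = 2` case of the stub `stub_equicontinuity`
feeding `stub_compactness`)

With the PINNED renormalisation `ρ_pin(δ) = ⟨σ₀σ_{⌊1/δ⌋e₀}⟩_{β_c}^{-1/2}` (`rhoPin`), the pinned PAIR zoom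
`F(k, x) = ρ_pin(u k)² ⟨σ_{[x₀/u k]} σ_{[x₁/u k]}⟩_{β_c}` along a mesh sequence `u k → 0⁺` is
ASYMPTOTICALLY EQUICONTINUOUS on every compact set `K` of non-coincident pairs, granted the two-point law
`⟨σ₀σ_y⟩_{β_c}‖y‖₂^{2Δ} → c > 0` (`y → ∞`; item stmt-0634, passed as data): for every `ε > 0` there is
`η > 0` with `|F(k, x) − F(k, y)| < ε` for all `x, y ∈ K` at sup-distance `< η` and all large `k`.

Proof (`ε/3` argument).
* CONTINUOUS CONVERGENCE (`tendsto_rescaledCorrelator_two_seq`, from the landed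
  `stub_pinnedTwoPoint` helpers): for pairs `x k → x₀` with `x₀ 0 ≠ x₀ 1`,
  `F(k, x k) → f x₀ := ‖x₀ 1 − x₀ 0‖^{-2Δ}` — the pair zoom is the ratio
  `⟨σ₀σ_{z_k}⟩/⟨σ₀σ_{⌊1/u k⌋e₀}⟩` (`rescaledCorrelator_rhoPin_two`) with `u k · z_k → x₀ 1 − x₀ 0 ≠ 0`.
* Continuous convergence to the function `f`, continuous off the diagonal, is UNIFORM convergence on
  compacts `K ⊆ NonCoincident 3 2` (`tendstoUniformlyOn_rescaledCorrelator_two`): otherwise there are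
  `ε₀ > 0`, `k_j → ∞` and `x_j ∈ K` with `|F(k_j, x_j) − f x_j| ≥ ε₀`; a subsequence of the `x_j`
  converges to some `x₀ ∈ K`, along it `F(k_j, x_j) → f x₀` and `f x_j → f x₀`, a contradiction.
* `f` is uniformly continuous on `K` (Heine–Cantor); with `η` its `ε/3`-modulus and `k` so large that
  `sup_K |F(k, ·) − f| < ε/3`, `|F(k,x) − F(k,y)| ≤ |F(k,x) − f x| + |f x − f y| + |f y − F(k,y)| < ε`.

References: H. Duminil-Copin, ICM 2022, §8.1 (two-point law); the rest is folklore real analysis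
(Heine–Cantor, `IsCompact.uniformContinuousOn_of_continuous`; sequential compactness,
`IsCompact.tendsto_subseq`). No definitions are introduced.
-/

noncomputable section

open Filter Topology Set Function
open Literature.Probability.LatticeModels

namespace Summit.CriticalPhenomena.Ising3DConformalLimit.MoebiusLimitExistsOnlyInteraction

/-! ### The pinned pair zoom along convergent sequences of pairs
(private copies, under fresh names, of `tendsto_mul_latticeApprox_sub_apply_of_tendsto`,
`tendsto_criticalTwoPoint_pin_mul_rpow`, `tendsto_rescaledCorrelator_two_of_tendsto` of the landed
`…MoebiusLimitExistsLocallyBounded`, whose module is not imported here) -/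

/-- Along a mesh sequence `u k → 0⁺` and a convergent sequence of pairs `x k → x₀`,
`u k · ([x k 1/u k] − [x k 0/u k])ᵢ → (x₀ 1 − x₀ 0)ᵢ` coordinatewise
(`|δ([q/δ]ᵢ − [p/δ]ᵢ) − (qᵢ − pᵢ)| ≤ 2δ`). [folklore] -/
private theorem tendsto_mul_latticeApprox_sub_apply_seq {u : ℕ → ℝ}
    (hu : Tendsto u atTop (𝓝[>] (0 : ℝ))) {x : ℕ → Fin 2 → EuclideanSpace ℝ (Fin 3)}
    {x₀ : Fin 2 → EuclideanSpace ℝ (Fin 3)} (hx : Tendsto x atTop (𝓝 x₀)) (i : Fin 3) :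
    Tendsto (fun k => u k * ((latticeApprox (u k) (x k 1) - latticeApprox (u k) (x k 0)) i : ℝ)) atTop
      (𝓝 ((x₀ 1 - x₀ 0) i)) := by
  -- adapted from …MoebiusLimitExistsLocallyBounded (same line, landed p73886)
  have hu0 : Tendsto u atTop (𝓝 0) := (tendsto_nhdsWithin_iff.1 hu).1
  have hupos : ∀ᶠ k in atTop, 0 < u k := (tendsto_nhdsWithin_iff.1 hu).2
  have hA : Tendsto (fun k => u k * ((latticeApprox (u k) (x k 1) - latticeApprox (u k) (x k 0)) i : ℝ)
      - (x k 1 - x k 0) i) atTop (𝓝 0) := by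
    rw [tendsto_zero_iff_norm_tendsto_zero]
    have h2 : Tendsto (fun k => 2 * u k) atTop (𝓝 0) := by
      simpa using hu0.const_mul (2 : ℝ)
    refine squeeze_zero' (Eventually.of_forall fun k => norm_nonneg _) ?_ h2
    filter_upwards [hupos] with k hk
    rw [Real.norm_eq_abs, Pi.sub_apply, Int.cast_sub, PiLp.sub_apply]
    exact abs_mul_sub_latticeApprox_sub_le hk (x k 1) (x k 0) i
  have hB : Tendsto (fun k => (x k 1 - x k 0) i) atTop (𝓝 ((x₀ 1 - x₀ 0) i)) := by
    have hc : Continuous fun z : Fin 2 → EuclideanSpace ℝ (Fin 3) => (z 1 - z 0) i := by fun_prop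
    exact (hc.tendsto x₀).comp hx
  have h := hA.add hB
  rw [zero_add] at h
  exact h.congr fun k => sub_add_cancel _ _

/-- The two-point function at the pinning site along a mesh sequence `u k → 0⁺` under the
two-point law: `⟨σ₀σ_{⌊1/u k⌋e₀}⟩_{β_c} (u k)^{-2Δ} → c` (`⌊1/δ⌋e₀ = [e₀/δ] − [0/δ]`, `δ⌊1/δ⌋ → 1`).
[folklore] -/
private theorem tendsto_criticalTwoPoint_pinSite_mul_rpow {Δ c : ℝ}
    (hG : Tendsto (fun y : Site 3 => criticalTwoPoint 3 y * Real.sqrt (∑ i, ((y i : ℝ)) ^ 2) ^ (2 * Δ))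
      cofinite (𝓝 c))
    {u : ℕ → ℝ} (hu : Tendsto u atTop (𝓝[>] (0 : ℝ))) :
    Tendsto (fun k => criticalTwoPoint 3 (Pi.single 0 (⌊1 / u k⌋ : ℤ) : Site 3) * (u k) ^ (-(2 * Δ)))
      atTop (𝓝 c) := by
  -- adapted from …MoebiusLimitExistsLocallyBounded / the landed `stub_pinnedTwoPoint` (denominator step)
  have he₀ : (EuclideanSpace.single 0 (1 : ℝ) : EuclideanSpace ℝ (Fin 3)) - 0 ≠ 0 := by
    rw [sub_zero, Ne, PiLp.single_eq_zero_iff]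
    exact one_ne_zero
  have h := tendsto_criticalTwoPoint_mul_rpow (Δ := Δ) hG hu he₀
    (fun i => tendsto_mul_latticeApprox_sub_apply hu 0 (EuclideanSpace.single 0 (1 : ℝ)) i)
  have h1 : ‖(EuclideanSpace.single 0 (1 : ℝ) : EuclideanSpace ℝ (Fin 3)) - 0‖ = 1 := by
    rw [sub_zero, PiLp.norm_single, norm_one]
  rw [h1, Real.one_rpow, mul_one] at h
  refine h.congr' (Eventually.of_forall fun k => ?_)
  simp only [piSingle_floor_eq_latticeApprox_sub]

/-- **Continuous convergence of the pinned pair zoom.** Under the two-point law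
`⟨σ₀σ_y⟩_{β_c}‖y‖₂^{2Δ} → c > 0`, along a mesh sequence `u k → 0⁺` and pairs `x k → x₀` with
`x₀ 0 ≠ x₀ 1`, `ρ_pin(u k)² ⟨σ_{[x k 0/u k]} σ_{[x k 1/u k]}⟩_{β_c} → ‖x₀ 1 − x₀ 0‖^{-2Δ}`: the pair zoom
is the ratio `⟨σ₀σ_{z_k}⟩/⟨σ₀σ_{⌊1/u k⌋e₀}⟩` with `u k · z_k → x₀ 1 − x₀ 0 ≠ 0`.
[cite: DuminilCopinICM2022, §8.1 eq. (8.1)–(8.2)] -/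
private theorem tendsto_rescaledCorrelator_two_seq {Δ c : ℝ} (hc : 0 < c)
    (hG : Tendsto (fun y : Site 3 => criticalTwoPoint 3 y * Real.sqrt (∑ i, ((y i : ℝ)) ^ 2) ^ (2 * Δ))
      cofinite (𝓝 c))
    {u : ℕ → ℝ} (hu : Tendsto u atTop (𝓝[>] (0 : ℝ))) {x : ℕ → Fin 2 → EuclideanSpace ℝ (Fin 3)}
    {x₀ : Fin 2 → EuclideanSpace ℝ (Fin 3)} (hx : Tendsto x atTop (𝓝 x₀)) (h01 : x₀ 0 ≠ x₀ 1) :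
    Tendsto (fun k => rescaledCorrelator (criticalCorr 3) rhoPin 2 (u k) (x k)) atTop
      (𝓝 (‖x₀ 1 - x₀ 0‖ ^ (-(2 * Δ)))) := by
  -- adapted from …MoebiusLimitExistsLocallyBounded (same line, landed p73886)
  have hupos : ∀ᶠ k in atTop, 0 < u k := (tendsto_nhdsWithin_iff.1 hu).2
  -- numerator: the two-point function at `z_k = [x k 1/u k] − [x k 0/u k]`
  have hz : Tendsto (fun k => criticalTwoPoint 3
      (latticeApprox (u k) (x k 1) - latticeApprox (u k) (x k 0)) * (u k) ^ (-(2 * Δ))) atTop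
      (𝓝 (c * ‖x₀ 1 - x₀ 0‖ ^ (-(2 * Δ)))) :=
    tendsto_criticalTwoPoint_mul_rpow hG hu (sub_ne_zero.2 h01.symm)
      (fun i => tendsto_mul_latticeApprox_sub_apply_seq hu hx i)
  -- denominator: the two-point function at the pinning site
  have hw := tendsto_criticalTwoPoint_pinSite_mul_rpow (Δ := Δ) hG hu
  have hq := hz.div hw hc.ne'
  rw [mul_div_assoc, mul_div_left_comm, div_self hc.ne', mul_one] at hq
  refine hq.congr' ?_
  filter_upwards [hupos] with k hk
  rw [Pi.div_apply, mul_div_mul_right _ _ (Real.rpow_pos_of_pos hk _).ne',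
    rescaledCorrelator_rhoPin_two]

/-! ### Uniform convergence of the pinned pair zoom on compacts -/

/-- The limit pair function `x ↦ ‖x 1 − x 0‖^{-2Δ}` is continuous at every non-coincident pair
(`t ↦ t^{-2Δ}` is continuous at `t ≠ 0`). [folklore] -/
theorem continuousAt_norm_sub_rpow (Δ : ℝ) {x₀ : Fin 2 → EuclideanSpace ℝ (Fin 3)}
    (h01 : x₀ 0 ≠ x₀ 1) :
    ContinuousAt (fun x : Fin 2 → EuclideanSpace ℝ (Fin 3) => ‖x 1 - x 0‖ ^ (-(2 * Δ))) x₀ := by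
  have hc : Continuous fun x : Fin 2 → EuclideanSpace ℝ (Fin 3) => ‖x 1 - x 0‖ := by fun_prop
  exact hc.continuousAt.rpow_const (Or.inl (norm_ne_zero_iff.2 (sub_ne_zero.2 h01.symm)))

/-- **Uniform convergence of the pinned pair zoom on compacts.** Under the two-point law
`⟨σ₀σ_y⟩_{β_c}‖y‖₂^{2Δ} → c > 0`, along a mesh sequence `u k → 0⁺` the pinned rescaled pair
correlators converge to `x ↦ ‖x 1 − x 0‖^{-2Δ}` UNIFORMLY on every compact set `K` of non-coincident
pairs: otherwise there are `ε > 0`, `k_j → ∞` and `x_j ∈ K` at distance `≥ ε` from the limit; a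
subsequence of the `x_j` converges to some `x₀ ∈ K`, and along it both the pair zoom (continuous
convergence, `tendsto_rescaledCorrelator_two_seq`) and the limit function (continuity off the
diagonal) tend to `‖x₀ 1 − x₀ 0‖^{-2Δ}`, a contradiction. [folklore] -/
theorem tendstoUniformlyOn_rescaledCorrelator_two {Δ c : ℝ} (hc : 0 < c)
    (hG : Tendsto (fun y : Site 3 => criticalTwoPoint 3 y * Real.sqrt (∑ i, ((y i : ℝ)) ^ 2) ^ (2 * Δ))
      cofinite (𝓝 c))
    {u : ℕ → ℝ} (hu : Tendsto u atTop (𝓝[>] (0 : ℝ)))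
    {K : Set (Fin 2 → EuclideanSpace ℝ (Fin 3))} (hK : IsCompact K) (hKs : K ⊆ NonCoincident 3 2) :
    TendstoUniformlyOn (fun k x => rescaledCorrelator (criticalCorr 3) rhoPin 2 (u k) x)
      (fun x => ‖x 1 - x 0‖ ^ (-(2 * Δ))) atTop K := by
  refine Metric.tendstoUniformlyOn_iff.2 fun ε hε => ?_
  by_contra hne
  rw [not_eventually] at hne
  obtain ⟨φ, hφ, hφK⟩ := extraction_of_frequently_atTop hne
  have hex : ∀ j, ∃ x ∈ K, ε ≤ dist (‖x 1 - x 0‖ ^ (-(2 * Δ)))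
      (rescaledCorrelator (criticalCorr 3) rhoPin 2 (u (φ j)) x) := by
    intro j
    by_contra h
    refine hφK j fun x hx => ?_
    by_contra hlt
    exact h ⟨x, hx, not_lt.1 hlt⟩
  choose x hxK hxε using hex
  obtain ⟨x₀, hx₀, ψ, hψ, hlim⟩ := hK.tendsto_subseq hxK
  have h01 : x₀ 0 ≠ x₀ 1 := ((mem_nonCoincident x₀).1 (hKs hx₀)).ne (by decide)
  have hu' : Tendsto (u ∘ φ ∘ ψ) atTop (𝓝[>] (0 : ℝ)) := hu.comp (hφ.comp hψ).tendsto_atTop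
  have hF := tendsto_rescaledCorrelator_two_seq (Δ := Δ) hc hG hu' hlim h01
  have hf : Tendsto (fun j => ‖(x ∘ ψ) j 1 - (x ∘ ψ) j 0‖ ^ (-(2 * Δ))) atTop
      (𝓝 (‖x₀ 1 - x₀ 0‖ ^ (-(2 * Δ)))) :=
    (continuousAt_norm_sub_rpow Δ h01).tendsto.comp hlim
  have hd := hf.dist hF
  rw [dist_self] at hd
  obtain ⟨j, hj⟩ := (hd.eventually (gt_mem_nhds hε)).exists
  exact absurd hj (not_lt.2 (hxε (ψ j)))

/-! ### The stub -/

/-- **Registered sub-goal `pinnedZoomEquicontinuous_two` (the `n = 2` case of `stub_equicontinuity`,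
line `only-interaction-breaks-moebius`) — asymptotic equicontinuity of the pinned pair zoom.** Under
the two-point law `⟨σ₀σ_y⟩_{β_c}‖y‖₂^{2Δ} → c > 0` (item stmt-0634, passed as data), along every mesh
sequence `u k → 0⁺`, on every compact set `K` of non-coincident pairs and for every `ε > 0` there is
`η > 0` such that, for all large `k`, the pinned rescaled critical pair correlators
`ρ_pin(u k)² ⟨σ_{[x₀/u k]} σ_{[x₁/u k]}⟩_{β_c}` differ by less than `ε` at any two configurations of `K`
at distance `< η`: the pair zoom converges uniformly on `K` to `f x = ‖x 1 − x 0‖^{-2Δ}`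
(`tendstoUniformlyOn_rescaledCorrelator_two`), `f` is uniformly continuous on `K` (Heine–Cantor), and
`|F(k,x) − F(k,y)| ≤ |F(k,x) − f x| + |f x − f y| + |f y − F(k,y)| < 3 · ε/3`. [folklore] -/
theorem pinnedZoomEquicontinuous_two :
    ∀ (Δ c : ℝ), 0 < c →
      Tendsto (fun y : Site 3 => criticalTwoPoint 3 y * Real.sqrt (∑ i, ((y i : ℝ)) ^ 2) ^ (2 * Δ))
        cofinite (𝓝 c) →
      ∀ u : ℕ → ℝ, Tendsto u atTop (𝓝[>] (0 : ℝ)) →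
        ∀ (K : Set (Fin 2 → EuclideanSpace ℝ (Fin 3))), IsCompact K → K ⊆ NonCoincident 3 2 →
          ∀ ε > 0, ∃ η > 0, ∀ᶠ k in atTop, ∀ x ∈ K, ∀ y ∈ K, dist x y < η →
            |rescaledCorrelator (criticalCorr 3) rhoPin 2 (u k) x -
              rescaledCorrelator (criticalCorr 3) rhoPin 2 (u k) y| < ε := by
  intro Δ c hc hG u hu K hK hKs ε hε
  have hε3 : (0 : ℝ) < ε / 3 := by positivity
  -- the limit pair function is uniformly continuous on `K`
  have hcont : ContinuousOn (fun x : Fin 2 → EuclideanSpace ℝ (Fin 3) => ‖x 1 - x 0‖ ^ (-(2 * Δ))) K :=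
    fun x hx => (continuousAt_norm_sub_rpow Δ
      (((mem_nonCoincident x).1 (hKs hx)).ne (by decide))).continuousWithinAt
  obtain ⟨η, hη, hηK⟩ := Metric.uniformContinuousOn_iff.1
    (hK.uniformContinuousOn_of_continuous hcont) (ε / 3) hε3
  -- the pair zoom is uniformly `ε/3`-close to the limit on `K` for all large `k`
  have hev := Metric.tendstoUniformlyOn_iff.1
    (tendstoUniformlyOn_rescaledCorrelator_two (Δ := Δ) hc hG hu hK hKs) (ε / 3) hε3
  refine ⟨η, hη, ?_⟩
  filter_upwards [hev] with k hk x hx y hy hxy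
  have h1 : dist (‖x 1 - x 0‖ ^ (-(2 * Δ))) (rescaledCorrelator (criticalCorr 3) rhoPin 2 (u k) x) <
      ε / 3 := hk x hx
  have h2 : dist (‖y 1 - y 0‖ ^ (-(2 * Δ))) (rescaledCorrelator (criticalCorr 3) rhoPin 2 (u k) y) <
      ε / 3 := hk y hy
  have h3 : dist (‖x 1 - x 0‖ ^ (-(2 * Δ))) (‖y 1 - y 0‖ ^ (-(2 * Δ))) < ε / 3 := hηK x hx y hy hxy
  rw [Real.dist_eq, abs_sub_lt_iff] at h1 h2 h3
  rw [abs_sub_lt_iff]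
  constructor <;> linarith [h1.1, h1.2, h2.1, h2.2, h3.1, h3.2]

end Summit.CriticalPhenomena.Ising3DConformalLimit.MoebiusLimitExistsOnlyInteraction

end
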